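import Literature.AlgebraicGeometry.Frobenioids.Composites
import Literature.AlgebraicGeometry.Frobenioids.PerfFactorial
import HarnessLib

/-!
# [FrdI] Theorem 4.2 (i)–(iii): the printed proof cut into named sub-lemmas (S5 sub-DAG, statements)

Mochizuki, *The geometry of Frobenioids I: the general theory*, Kyushu J. Math. **62** (2008)
293–400, §4, Theorem 4.2, statement p. 77 l. 23 – p. 78, proof p. 78 l. 28 – p. 81 l. 62
[cite: MochizukiFrdI2008, Thm. 4.2 p.77] (render `paper:url-bbf705efa10f`).

STATEMENTS-ONLY file (D-0068 (1), sub-DAG `plan/L1/SUBDAG-FrdI-Thm42-Thm49.md`, rows `T42-L01…L13`,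
holder abc-iut-L1-t14): each printed step of the proof of Thm. 4.2 is a NAMED `Prop` (nothing is
asserted), in the vocabulary of the tree's Def. 1.3 API (`PreFrobenioid.*`), phrased EXACTLY as the
kernel-checked theorems of the holder's proof files where those exist, so that each row closes by a
one-line `theorem <Name>_holds : <Name>`:
* `T42-L04` `PrimaryStepsAtDivFrobTrivial` — PROVED: `PreFrobenioid.isPrimaryPreStep_map_of_divFrobeniusTrivial`,
  `isPrimaryPreStep_comp_map`, `isPrimaryPreStep_map_of_from` (`PrimaryStepsTransport.lean`);
* `T42-L08` `PsiPrimeBijection` — PROVED: `PreFrobenioid.existsUnique_primesEquiv_family` (`PrimesEquivalence.lean`);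
* `T42-L12` `MonoidIsosAtDivFrobTrivial` — PROVED: `PreFrobenioid.exists_rightIso` / `exists_leftIso`
  (`PrimesMonoidIso{Left,Right}.lean`), with the monoid kernel `IsMonoprime.map_mul_of_dvd_iff_of_pow`
  (`MonoprimeEquivMul.lean`, seat abc-iut-L1-d10) = row `T42-L13` (not restated here);
* `T42-L02` (b)(c) formal part — PROVED: `PreFrobenioid.isDivFrobeniusTrivial_map`,
  `isUniversallyDivFrobeniusTrivial_map` (`DivFrobeniusTrivialTransport.lean`); (a) = the cell's
  `FrdI.isDivIdentity_isPrimeFrobenius_map` (seat abc-iut-L1-t13, FSM-type bases);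
* the other rows (`L01`, `L03`, `L05`–`L07`, `L09`–`L11`) are OPEN; rows `L09`–`L11` (functoriality of
  `Ψ^Prime`, Div-identity endomorphisms) are stated in the companion file `Thm42SubII.lean`.
The closing types of Thm. 4.2 (i)/(ii)/(iii) themselves are `PreFrobenioidData.Thm42i/Thm42ii/Thm42iii`
(`DivisorMonoidCategoryTheoreticityDefs.lean`, seat abc-iut-L1-t3); (ii)/(iii) are reached from these rows
by `thm42ii_of_perfectType` / `thm42iii_of` (`DivisorMonoidCategoryTheoreticityThm42.lean`).

SETTING. The proof first reduces to NON-GROUP-LIKE objects (`L01`) and to PERFECT type (`L03`, "passing to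
the perfections") and uses throughout the conclusions of Thm. 3.4 (ii)(iii) for `Ψ` and a quasi-inverse;
`T42.Setting F₁ F₂ Ψ` records exactly this as a structure of HYPOTHESES (to be instantiated by the §3
discharges, e.g. `FrdI.isPreStep_map_of_isOfFSMType` over bases of FSM-type). Same universes on both sides,
as in `FrdI.Thm42i`. Composition diagrammatic; monoids multiplicative (`Φ(A)_𝔭 = Primes.submonoid 𝔭`,
`ψ_*Div ψ = invDiv F ψ _`). No instance, no notation, nothing asserted.
-/

namespace Literature.AlgebraicGeometry.Frobenioids

open CategoryTheory Opposite

namespace FrdI.T42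

universe w v v' u u'

variable {D₁ : Type u} [Category.{v} D₁] {Φ₁ : D₁ᵒᵖ ⥤ CommMonCat.{w}} {C₁ : Type u'} [Category.{v'} C₁]
  {D₂ : Type u} [Category.{v} D₂] {Φ₂ : D₂ᵒᵖ ⥤ CommMonCat.{w}} {C₂ : Type u'} [Category.{v'} C₂]

/-! ## The setting after the reductions of rows L01 and L03 -/

/-- **Setting of the proof of Thm. 4.2 after its two reductions** (p. 78 ll. 28–46): `C_i → F_{Φ_i}`
Frobenioids of PERFECT and isotropic type with `Φ_i` perf-factorial, an equivalence `Ψ : C₁ ≌ C₂`, and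
the conclusions of Thm. 3.4 (ii)(iii) for `Ψ` and its quasi-inverse recorded as fields ("`Ψ` preserves
pre-steps … morphisms of Frobenius type and Frobenius degrees … pull-back morphisms", pp. 78–81) — a
structure of HYPOTHESES, instantiated by the §3 discharges. [cite: MochizukiFrdI2008, Thm. 4.2 p.78] -/
structure Setting (F₁ : C₁ ⥤ ElemFrobenioid Φ₁) (F₂ : C₂ ⥤ ElemFrobenioid Φ₂) (Ψ : C₁ ≌ C₂) : Prop where
  /-- `C₁` is a Frobenioid -/
  isFrobenioid₁ : PreFrobenioid.IsFrobenioid F₁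
  /-- `C₂` is a Frobenioid -/
  isFrobenioid₂ : PreFrobenioid.IsFrobenioid F₂
  /-- of perfect type (after "passing to the perfections") -/
  perfect₁ : PreFrobenioid.IsOfPerfectType F₁
  /-- of perfect type -/
  perfect₂ : PreFrobenioid.IsOfPerfectType F₂
  /-- of isotropic type (hypothesis of Thm. 4.2) -/
  isotropic₁ : PreFrobenioid.IsOfIsotropicType F₁
  /-- of isotropic type -/
  isotropic₂ : PreFrobenioid.IsOfIsotropicType F₂
  /-- `Φ₁` perf-factorial (Def. 2.4 (i)) -/
  perfFactorial₁ : Objectwise (fun M _ => IsPerfFactorial M) Φ₁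
  /-- `Φ₂` perf-factorial -/
  perfFactorial₂ : Objectwise (fun M _ => IsPerfFactorial M) Φ₂
  /-- Thm. 3.4 (ii): `Ψ` preserves pre-steps -/
  preStep_map : ∀ ⦃X Y : C₁⦄ (φ : X ⟶ Y),
    PreFrobenioid.IsPreStep F₁ φ → PreFrobenioid.IsPreStep F₂ (Ψ.functor.map φ)
  /-- Thm. 3.4 (ii) for the quasi-inverse -/
  preStep_inv : ∀ ⦃X Y : C₂⦄ (φ : X ⟶ Y),
    PreFrobenioid.IsPreStep F₂ φ → PreFrobenioid.IsPreStep F₁ (Ψ.inverse.map φ)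
  /-- steps are preserved (pre-steps + reflection of isomorphisms) -/
  step_map : ∀ ⦃X Y : C₁⦄ (φ : X ⟶ Y),
    PreFrobenioid.IsStep F₁ φ → PreFrobenioid.IsStep F₂ (Ψ.functor.map φ)
  /-- steps, quasi-inverse -/
  step_inv : ∀ ⦃X Y : C₂⦄ (φ : X ⟶ Y),
    PreFrobenioid.IsStep F₂ φ → PreFrobenioid.IsStep F₁ (Ψ.inverse.map φ)
  /-- Thm. 3.4 (iii): morphisms of Frobenius type are preserved -/
  frobeniusType_map : ∀ ⦃X Y : C₁⦄ (φ : X ⟶ Y),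
    PreFrobenioid.IsFrobeniusType F₁ φ → PreFrobenioid.IsFrobeniusType F₂ (Ψ.functor.map φ)
  /-- Thm. 3.4 (iii), quasi-inverse -/
  frobeniusType_inv : ∀ ⦃X Y : C₂⦄ (φ : X ⟶ Y),
    PreFrobenioid.IsFrobeniusType F₂ φ → PreFrobenioid.IsFrobeniusType F₁ (Ψ.inverse.map φ)
  /-- Thm. 3.4 (iii): Frobenius degrees are preserved (`Ψ^{ℕ≥1} = id`, non-group-like case) -/
  degFr_map : ∀ ⦃X Y : C₁⦄ (φ : X ⟶ Y), PreFrobenioid.degFr F₂ (Ψ.functor.map φ) = PreFrobenioid.degFr F₁ φ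
  /-- Thm. 3.4 (iii): pull-back morphisms are preserved -/
  pullback_map : ∀ ⦃X Y : C₁⦄ (φ : X ⟶ Y),
    PreFrobenioid.IsPullbackMorphism F₁ φ → PreFrobenioid.IsPullbackMorphism F₂ (Ψ.functor.map φ)
  /-- Thm. 3.4 (iii), quasi-inverse -/
  pullback_inv : ∀ ⦃X Y : C₂⦄ (φ : X ⟶ Y),
    PreFrobenioid.IsPullbackMorphism F₂ φ → PreFrobenioid.IsPullbackMorphism F₁ (Ψ.inverse.map φ)

/-- "`Ψ` maps primary steps to or from `A₁` to primary steps to or from `A₂`" with primary composites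
`B₁ → A₁ → C₁` (p. 78 ll. 47–53) — the property propagated in rows L04–L07. [cite: MochizukiFrdI2008, Thm. 4.2 (i) p.78] -/
def PreservesPrimaryAt (F₁ : C₁ ⥤ ElemFrobenioid Φ₁) (F₂ : C₂ ⥤ ElemFrobenioid Φ₂) (Ψ : C₁ ≌ C₂)
    (A : C₁) : Prop :=
  (∀ ⦃B : C₁⦄ (φ : B ⟶ A), PreFrobenioid.IsStep F₁ φ → PreFrobenioid.IsPrimaryPreStep F₁ φ →
      PreFrobenioid.IsPrimaryPreStep F₂ (Ψ.functor.map φ)) ∧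
    (∀ ⦃B : C₁⦄ (ψ : A ⟶ B), PreFrobenioid.IsStep F₁ ψ → PreFrobenioid.IsPrimaryPreStep F₁ ψ →
      PreFrobenioid.IsPrimaryPreStep F₂ (Ψ.functor.map ψ)) ∧
    ∀ ⦃B B' : C₁⦄ (φ : B ⟶ A) (ψ : A ⟶ B'), PreFrobenioid.IsStep F₁ φ →
      PreFrobenioid.IsPrimaryPreStep F₁ φ → PreFrobenioid.IsStep F₁ ψ →
        PreFrobenioid.IsPrimaryPreStep F₁ (φ ≫ ψ) → PreFrobenioid.IsPrimaryPreStep F₁ ψ →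
          PreFrobenioid.IsPrimaryPreStep F₂ (Ψ.functor.map φ ≫ Ψ.functor.map ψ)

/-! ## T42-L01 — reduction to non-group-like objects (p. 78 ll. 28–35) -/

/-- **T42-L01** `GroupLikeWLOG` (p. 78 ll. 28–35): "by Proposition 1.10, (vi), every group-like object is
Frobenius-trivial, hence, in particular, Div-Frobenius-trivial; moreover, every endomorphism of a
group-like object is a Div-identity endomorphism, and every pre-step to or from a group-like object is an
isomorphism [cf. Propositions 1.4, (i), (iii); 1.8, (iii)]" — for a Frobenioid of isotropic type.
(Frobenius-triviality: the tree's `PreFrobenioid.isFrobeniusTrivial_of_isGroupLikeObj_of_isOfIsotropicType`.)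
[cite: MochizukiFrdI2008, Thm. 4.2 (i) p.78] -/
def GroupLikeWLOG : Prop :=
  ∀ {D : Type u} [Category.{v} D] {Φ : Dᵒᵖ ⥤ CommMonCat.{w}} {C : Type u'} [Category.{v'} C]
    (F : C ⥤ ElemFrobenioid Φ), PreFrobenioid.IsFrobenioid F → PreFrobenioid.IsOfIsotropicType F →
    ∀ (A : C), PreFrobenioid.IsGroupLikeObj F A →
      PreFrobenioid.IsDivFrobeniusTrivial F A ∧
        (∀ α : A ⟶ A, PreFrobenioid.IsDivIdentity F α) ∧
        (∀ ⦃B : C⦄ (φ : B ⟶ A), PreFrobenioid.IsPreStep F φ → IsIso φ) ∧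
        ∀ ⦃B : C⦄ (φ : A ⟶ B), PreFrobenioid.IsPreStep F φ → IsIso φ

/-! ## T42-L02 — Div-Frobenius-trivial objects and Div-identity prime-Frobenius endomorphisms (p. 78 ll. 36–38) -/

/-- **T42-L02** `PreservesDivFrobTrivial` (p. 78 ll. 36–38): "by Proposition 1.14, (v) [cf. also Theorem
3.4, (ii)], `Ψ` preserves non-group-like Div-Frobenius-trivial objects, as well as Div-identity
prime-Frobenius endomorphisms of such objects" — and (with pull-backs preserved, Thm. 3.4 (iii)) universally
Div-Frobenius-trivial objects. Clause (a) is the cell's `FrdI.isDivIdentity_isPrimeFrobenius_map` (FSM-type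
bases); (b)(c) then follow by `PreFrobenioid.isDivFrobeniusTrivial_map` / `isUniversallyDivFrobeniusTrivial_map`.
[cite: MochizukiFrdI2008, Thm. 4.2 (i) p.78] -/
def PreservesDivFrobTrivial : Prop :=
  ∀ {D₁ : Type u} [Category.{v} D₁] {Φ₁ : D₁ᵒᵖ ⥤ CommMonCat.{w}} {C₁ : Type u'} [Category.{v'} C₁]
    {D₂ : Type u} [Category.{v} D₂] {Φ₂ : D₂ᵒᵖ ⥤ CommMonCat.{w}} {C₂ : Type u'} [Category.{v'} C₂]
    (F₁ : C₁ ⥤ ElemFrobenioid Φ₁) (F₂ : C₂ ⥤ ElemFrobenioid Φ₂) (Ψ : C₁ ≌ C₂), Setting F₁ F₂ Ψ →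
    (∀ (A : C₁), ¬ PreFrobenioid.IsGroupLikeObj F₁ A → ∀ α : A ⟶ A, PreFrobenioid.IsDivIdentity F₁ α →
        PreFrobenioid.IsPrimeFrobenius F₁ α → PreFrobenioid.IsDivIdentity F₂ (Ψ.functor.map α)) ∧
    (∀ (A : C₁), ¬ PreFrobenioid.IsGroupLikeObj F₁ A → PreFrobenioid.IsDivFrobeniusTrivial F₁ A →
        PreFrobenioid.IsDivFrobeniusTrivial F₂ (Ψ.functor.obj A)) ∧
    ∀ (A : C₁), ¬ PreFrobenioid.IsGroupLikeObj F₁ A → PreFrobenioid.IsUniversallyDivFrobeniusTrivial F₁ A →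
        PreFrobenioid.IsUniversallyDivFrobeniusTrivial F₂ (Ψ.functor.obj A)

/-! ## T42-L03 — reduction to Frobenioids of perfect type (p. 78 ll. 40–46) -/

/-- **T42-L03** `PerfectWLOG`, formal part (p. 78 ll. 40–46): "to prove … that `Ψ` preserves primary steps
and Div-identity endomorphisms … it suffices to do so after passing to the perfections of the `C_i` [cf.
Theorem 3.4, (iii)]". Rendered as the transport principle it rests on: for functors `P_i : C_i → C_i'`
("`C → C^pf`") and an equivalence `Ψ'` ("`Ψ^pf`") with `Ψ' ∘ P₁ ≅ P₂ ∘ Ψ` such that the `P_i` PRESERVE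
AND REFLECT primary pre-steps and Div-identity endomorphisms [Prop. 3.2, Prop. 5.5 (iii) — inputs], if
`Ψ'` preserves primary pre-steps (resp. Div-identity endomorphisms) then so does `Ψ`.
[cite: MochizukiFrdI2008, Thm. 4.2 (i) p.78] -/
def PerfectWLOG : Prop :=
  ∀ {D₁ : Type u} [Category.{v} D₁] {Φ₁ : D₁ᵒᵖ ⥤ CommMonCat.{w}} {C₁ : Type u'} [Category.{v'} C₁]
    {D₂ : Type u} [Category.{v} D₂] {Φ₂ : D₂ᵒᵖ ⥤ CommMonCat.{w}} {C₂ : Type u'} [Category.{v'} C₂]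
    {C₁' : Type u'} [Category.{v'} C₁'] {C₂' : Type u'} [Category.{v'} C₂']
    (F₁ : C₁ ⥤ ElemFrobenioid Φ₁) (F₂ : C₂ ⥤ ElemFrobenioid Φ₂) (F₁' : C₁' ⥤ ElemFrobenioid Φ₁)
    (F₂' : C₂' ⥤ ElemFrobenioid Φ₂) (Ψ : C₁ ≌ C₂) (Ψ' : C₁' ≌ C₂') (P₁ : C₁ ⥤ C₁') (P₂ : C₂ ⥤ C₂'),
    Nonempty (P₁ ⋙ Ψ'.functor ≅ Ψ.functor ⋙ P₂) →
    IsPreFrobenioid Φ₂ F₂ → IsPreFrobenioid Φ₂ F₂' →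
    (∀ ⦃X Y : C₁⦄ (φ : X ⟶ Y), PreFrobenioid.IsPrimaryPreStep F₁ φ ↔
        PreFrobenioid.IsPrimaryPreStep F₁' (P₁.map φ)) →
    (∀ ⦃X Y : C₂⦄ (φ : X ⟶ Y), PreFrobenioid.IsPrimaryPreStep F₂ φ ↔
        PreFrobenioid.IsPrimaryPreStep F₂' (P₂.map φ)) →
    (∀ ⦃X : C₁⦄ (α : X ⟶ X), PreFrobenioid.IsDivIdentity F₁ α ↔ PreFrobenioid.IsDivIdentity F₁' (P₁.map α)) →
    (∀ ⦃X : C₂⦄ (α : X ⟶ X), PreFrobenioid.IsDivIdentity F₂ α ↔ PreFrobenioid.IsDivIdentity F₂' (P₂.map α)) →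
      ((∀ ⦃X Y : C₁'⦄ (φ : X ⟶ Y), PreFrobenioid.IsPrimaryPreStep F₁' φ →
          PreFrobenioid.IsPrimaryPreStep F₂' (Ψ'.functor.map φ)) →
        ∀ ⦃X Y : C₁⦄ (φ : X ⟶ Y), PreFrobenioid.IsPrimaryPreStep F₁ φ →
          PreFrobenioid.IsPrimaryPreStep F₂ (Ψ.functor.map φ)) ∧
      ((∀ ⦃X : C₁'⦄ (α : X ⟶ X), PreFrobenioid.IsDivIdentity F₁' α →
          PreFrobenioid.IsDivIdentity F₂' (Ψ'.functor.map α)) →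
        ∀ ⦃X : C₁⦄ (α : X ⟶ X), PreFrobenioid.IsDivIdentity F₁ α →
          PreFrobenioid.IsDivIdentity F₂ (Ψ.functor.map α))

/-! ## T42-L04 — primary steps at a Div-Frobenius-trivial object (p. 78 ll. 47–53) — PROVED -/

/-- **T42-L04** `PrimaryStepsAtDivFrobTrivial` (p. 78 ll. 47–53): "let `A₁` be a non-group-like
Div-Frobenius-trivial object … it follows formally from Proposition 4.1, (i), (ii) [cf. also Theorem 3.4,
(ii), (iii)] that `Ψ` maps primary steps to or from `A₁` to primary steps to or from `A₂`" with primary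
composites — for `A` carrying Div-identity Frobenius-type endomorphisms `α_n` of every degree `n` whose
images `Ψ(α_n)` are again such (row L02). PROVED: `PreFrobenioid.isPrimaryPreStep_map_of_divFrobeniusTrivial`,
`isPrimaryPreStep_comp_map`, `isPrimaryPreStep_map_of_from`. [cite: MochizukiFrdI2008, Thm. 4.2 (i) p.78] -/
def PrimaryStepsAtDivFrobTrivial : Prop :=
  ∀ {D₁ : Type u} [Category.{v} D₁] {Φ₁ : D₁ᵒᵖ ⥤ CommMonCat.{w}} {C₁ : Type u'} [Category.{v'} C₁]
    {D₂ : Type u} [Category.{v} D₂] {Φ₂ : D₂ᵒᵖ ⥤ CommMonCat.{w}} {C₂ : Type u'} [Category.{v'} C₂]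
    (F₁ : C₁ ⥤ ElemFrobenioid Φ₁) (F₂ : C₂ ⥤ ElemFrobenioid Φ₂) (Ψ : C₁ ≌ C₂), Setting F₁ F₂ Ψ →
    ∀ {A : C₁} (α : ℕ+ → (A ⟶ A)),
      (∀ n, PreFrobenioid.IsDivIdentity F₁ (α n) ∧ PreFrobenioid.IsFrobeniusType F₁ (α n) ∧
        PreFrobenioid.degFr F₁ (α n) = n) →
      (∀ n, PreFrobenioid.IsDivIdentity F₂ (Ψ.functor.map (α n)) ∧
        PreFrobenioid.IsFrobeniusType F₂ (Ψ.functor.map (α n)) ∧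
          PreFrobenioid.degFr F₂ (Ψ.functor.map (α n)) = n) →
      PreservesPrimaryAt F₁ F₂ Ψ A

/-! ## T42-L05 – L07 — propagation of the primary-step property (p. 78 l. 54 – p. 80 l. 17) -/

/-- **T42-L05** `PrimaryStepsPropagateAlongPrimaryStep` (p. 78 l. 54 – p. 79 l. 22): "let `A₁ → F₁` be a
primary step. Then it follows immediately from Proposition 4.1, (iii), together with what we have already
shown concerning primary steps to or from `A₁`, that `Ψ` maps primary steps to or from `F₁` to primary steps
to or from `F₂`" with primary composites "[… (a) … subordinate to the primary composite …; (b) … both the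
upper and lower squares are cartesian diagrams as in Proposition 4.1, (iii) …]".
[cite: MochizukiFrdI2008, Thm. 4.2 (i) p.79] -/
def PrimaryStepsPropagateAlongPrimaryStep : Prop :=
  ∀ {D₁ : Type u} [Category.{v} D₁] {Φ₁ : D₁ᵒᵖ ⥤ CommMonCat.{w}} {C₁ : Type u'} [Category.{v'} C₁]
    {D₂ : Type u} [Category.{v} D₂] {Φ₂ : D₂ᵒᵖ ⥤ CommMonCat.{w}} {C₂ : Type u'} [Category.{v'} C₂]
    (F₁ : C₁ ⥤ ElemFrobenioid Φ₁) (F₂ : C₂ ⥤ ElemFrobenioid Φ₂) (Ψ : C₁ ≌ C₂), Setting F₁ F₂ Ψ →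
    ∀ {A F : C₁} (ε : A ⟶ F), PreFrobenioid.IsStep F₁ ε → PreFrobenioid.IsPrimaryPreStep F₁ ε →
      PreservesPrimaryAt F₁ F₂ Ψ A → PreservesPrimaryAt F₁ F₂ Ψ F

/-- **T42-L06** `PrimaryStepsPropagateToB` (p. 79 ll. 23–42): for (a Frobenius-trivial) `A₁` and pre-steps
`B₁ → C₁`, `B₁ → A₁` (Def. 1.3 (i)(a)(b)), "any primary step to or from `B₁` … may always be written in the
form `D₁ → E₁` where the composite `D₁ → E₁ → F₁` … factors as a composite `D₁ → B₁ → A₁ → F₁` … Thus, by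
applying Proposition 4.1, (iv) …, together with what we have already shown concerning primary steps to or
from `F₁`, we conclude that `Ψ` maps primary steps to or from `B₁` to primary steps to or from `B₂`".
[cite: MochizukiFrdI2008, Thm. 4.2 (i) p.79] -/
def PrimaryStepsPropagateToB : Prop :=
  ∀ {D₁ : Type u} [Category.{v} D₁] {Φ₁ : D₁ᵒᵖ ⥤ CommMonCat.{w}} {C₁ : Type u'} [Category.{v'} C₁]
    {D₂ : Type u} [Category.{v} D₂] {Φ₂ : D₂ᵒᵖ ⥤ CommMonCat.{w}} {C₂ : Type u'} [Category.{v'} C₂]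
    (F₁ : C₁ ⥤ ElemFrobenioid Φ₁) (F₂ : C₂ ⥤ ElemFrobenioid Φ₂) (Ψ : C₁ ≌ C₂), Setting F₁ F₂ Ψ →
    ∀ {A B : C₁} (ζ : B ⟶ A), PreFrobenioid.IsPreStep F₁ ζ → PreFrobenioid.IsFrobeniusTrivial F₁ A →
      PreservesPrimaryAt F₁ F₂ Ψ A →
      (∀ ⦃F : C₁⦄ (ε : A ⟶ F), PreFrobenioid.IsStep F₁ ε → PreFrobenioid.IsPrimaryPreStep F₁ ε →
          PreservesPrimaryAt F₁ F₂ Ψ F) →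
        PreservesPrimaryAt F₁ F₂ Ψ B

/-- **T42-L07** `PrimaryStepsPropagateFromB` (p. 79 l. 43 – p. 80 l. 17): "in a similar vein … by applying
Proposition 4.1, (v) …, together with what we have already shown concerning primary steps to or from `D₁`
…, we conclude that `Ψ` maps primary steps to or from `C₁` to primary steps to or from `C₂` … Since `C₁`
was, in effect, allowed to be an arbitrary non-group-like object of `C₁`, we thus conclude that `Ψ`
preserves primary steps." [cite: MochizukiFrdI2008, Thm. 4.2 (i) p.80] -/
def PrimaryStepsPropagateFromB : Prop :=
  ∀ {D₁ : Type u} [Category.{v} D₁] {Φ₁ : D₁ᵒᵖ ⥤ CommMonCat.{w}} {C₁ : Type u'} [Category.{v'} C₁]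
    {D₂ : Type u} [Category.{v} D₂] {Φ₂ : D₂ᵒᵖ ⥤ CommMonCat.{w}} {C₂ : Type u'} [Category.{v'} C₂]
    (F₁ : C₁ ⥤ ElemFrobenioid Φ₁) (F₂ : C₂ ⥤ ElemFrobenioid Φ₂) (Ψ : C₁ ≌ C₂), Setting F₁ F₂ Ψ →
    ∀ {A B X : C₁} (ζ : B ⟶ A) (ξ : B ⟶ X), PreFrobenioid.IsPreStep F₁ ζ → PreFrobenioid.IsPreStep F₁ ξ →
      PreFrobenioid.IsFrobeniusTrivial F₁ A →
      (∀ ⦃B' : C₁⦄ (ζ' : B' ⟶ A), PreFrobenioid.IsPreStep F₁ ζ' → PreservesPrimaryAt F₁ F₂ Ψ B') →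
        PreservesPrimaryAt F₁ F₂ Ψ X

/-- **T42-L07, conclusion** `PrimaryStepsPreserved` (p. 80 ll. 15–17): "`Ψ` preserves primary steps"
(perfect-type setting, given row L02 (a)). [cite: MochizukiFrdI2008, Thm. 4.2 (i) p.80] -/
def PrimaryStepsPreserved : Prop :=
  ∀ {D₁ : Type u} [Category.{v} D₁] {Φ₁ : D₁ᵒᵖ ⥤ CommMonCat.{w}} {C₁ : Type u'} [Category.{v'} C₁]
    {D₂ : Type u} [Category.{v} D₂] {Φ₂ : D₂ᵒᵖ ⥤ CommMonCat.{w}} {C₂ : Type u'} [Category.{v'} C₂]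
    (F₁ : C₁ ⥤ ElemFrobenioid Φ₁) (F₂ : C₂ ⥤ ElemFrobenioid Φ₂) (Ψ : C₁ ≌ C₂), Setting F₁ F₂ Ψ →
    (∀ (A : C₁), ¬ PreFrobenioid.IsGroupLikeObj F₁ A → ∀ α : A ⟶ A, PreFrobenioid.IsDivIdentity F₁ α →
        PreFrobenioid.IsPrimeFrobenius F₁ α → PreFrobenioid.IsDivIdentity F₂ (Ψ.functor.map α)) →
    ∀ ⦃X Y : C₁⦄ (φ : X ⟶ Y), PreFrobenioid.IsPrimaryPreStep F₁ φ →
      PreFrobenioid.IsPrimaryPreStep F₂ (Ψ.functor.map φ)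

/-! ## T42-L08 — the bijection `Ψ^Prime(A)` (p. 80 ll. 18–33) — PROVED modulo L07 -/

/-- **T42-L08** `PsiPrimeBijection` (p. 80 ll. 18–33): "by thinking … of an element of `Prime(Φ_i(A_i))` as an
equivalence class of primary steps to or from `A_i` [… defined by `Div(−)` …], we thus obtain that `Ψ`
induces a bijection `Ψ^Prime(A₁) : Prime(Φ₁(A₁)) ≅ Prime(Φ₂(A₂))`" together with the two restricted
equivalences — as the unique family `e` with the two clauses of the typed `Thm42ii` (co-angular pre-steps
out of / into `A`). PROVED from "`Ψ`, `Ψ⁻¹` preserve primary pre-steps" [L07]: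
`PreFrobenioid.existsUnique_primesEquiv_family`. [cite: MochizukiFrdI2008, Thm. 4.2 (ii) p.80] -/
def PsiPrimeBijection : Prop :=
  ∀ {D₁ : Type u} [Category.{v} D₁] {Φ₁ : D₁ᵒᵖ ⥤ CommMonCat.{w}} {C₁ : Type u'} [Category.{v'} C₁]
    {D₂ : Type u} [Category.{v} D₂] {Φ₂ : D₂ᵒᵖ ⥤ CommMonCat.{w}} {C₂ : Type u'} [Category.{v'} C₂]
    (F₁ : C₁ ⥤ ElemFrobenioid Φ₁) (F₂ : C₂ ⥤ ElemFrobenioid Φ₂) (Ψ : C₁ ≌ C₂), Setting F₁ F₂ Ψ →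
    (∀ ⦃X Y : C₁⦄ (φ : X ⟶ Y), PreFrobenioid.IsPrimaryPreStep F₁ φ →
        PreFrobenioid.IsPrimaryPreStep F₂ (Ψ.functor.map φ)) →
    (∀ ⦃X Y : C₂⦄ (φ : X ⟶ Y), PreFrobenioid.IsPrimaryPreStep F₂ φ →
        PreFrobenioid.IsPrimaryPreStep F₁ (Ψ.inverse.map φ)) →
    ∃! e : ∀ A : C₁, Primes (Φ₁.obj (op (PreFrobenioid.baseObj F₁ A))) ≃
        Primes (Φ₂.obj (op (PreFrobenioid.baseObj F₂ (Ψ.functor.obj A)))),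
      ∀ (A : C₁) (𝔭 : Primes (Φ₁.obj (op (PreFrobenioid.baseObj F₁ A)))),
        (∀ ⦃B : C₁⦄ (φ : A ⟶ B), PreFrobenioid.IsCoAngularPreStep F₁ φ →
            (PreFrobenioid.Div F₁ φ ∈ 𝔭.submonoid ↔
              PreFrobenioid.Div F₂ (Ψ.functor.map φ) ∈ (e A 𝔭).submonoid)) ∧
        ∀ ⦃B : C₁⦄ (ψ : B ⟶ A), PreFrobenioid.IsCoAngularPreStep F₁ ψ →
          ((∃ y ∈ 𝔭.submonoid, pull Φ₁ (PreFrobenioid.Base F₁ ψ) y = PreFrobenioid.Div F₁ ψ) ↔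
            ∃ y ∈ (e A 𝔭).submonoid,
              pull Φ₂ (PreFrobenioid.Base F₂ (Ψ.functor.map ψ)) y = PreFrobenioid.Div F₂ (Ψ.functor.map ψ))

/-! ## T42-L12 — the monoid isomorphisms at a Div-Frobenius-trivial object (p. 81 ll. 32–58) — PROVED -/

/-- **T42-L12** `MonoidIsosAtDivFrobTrivial` (p. 81 ll. 32–58): for Div-Frobenius-trivial `A` and primes
`𝔭 ⊆ Φ₁(A)`, `𝔭' ⊆ Φ₂(Ψ A)` corresponding as in (ii) [clauses (a), (b)], "the equivalences of categories in
question arise from bijections of sets `Φ₁(A₁)_𝔭₁ ≅ Φ₂(A₂)_𝔭₂` that are compatible both with `≤` and with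
multiplication by elements of `ℕ≥1` … [hence] isomorphisms of monoids" — the right-hand one computing
`Div(Ψ φ)`, the left-hand one `(Ψψ)_*Div(Ψψ)`. PROVED: `PreFrobenioid.exists_rightIso`, `exists_leftIso`
(monoid kernel: row L13 = `IsMonoprime.map_mul_of_dvd_iff_of_pow`, seat abc-iut-L1-d10).
[cite: MochizukiFrdI2008, Thm. 4.2 (iii) p.81] -/
def MonoidIsosAtDivFrobTrivial : Prop :=
  ∀ {D₁ : Type u} [Category.{v} D₁] {Φ₁ : D₁ᵒᵖ ⥤ CommMonCat.{w}} {C₁ : Type u'} [Category.{v'} C₁]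
    {D₂ : Type u} [Category.{v} D₂] {Φ₂ : D₂ᵒᵖ ⥤ CommMonCat.{w}} {C₂ : Type u'} [Category.{v'} C₂]
    (F₁ : C₁ ⥤ ElemFrobenioid Φ₁) (F₂ : C₂ ⥤ ElemFrobenioid Φ₂) (Ψ : C₁ ≌ C₂), Setting F₁ F₂ Ψ →
    ∀ {A : C₁}, PreFrobenioid.IsDivFrobeniusTrivial F₁ A →
      (∀ α : A ⟶ A, PreFrobenioid.IsDivIdentity F₁ α → PreFrobenioid.IsDivIdentity F₂ (Ψ.functor.map α)) →
      ∀ (𝔭 : Primes (Φ₁.obj (op (PreFrobenioid.baseObj F₁ A))))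
        (𝔭' : Primes (Φ₂.obj (op (PreFrobenioid.baseObj F₂ (Ψ.functor.obj A))))),
        (∀ ⦃B : C₁⦄ (φ : A ⟶ B), PreFrobenioid.IsCoAngularPreStep F₁ φ →
            (PreFrobenioid.Div F₁ φ ∈ 𝔭.submonoid ↔ PreFrobenioid.Div F₂ (Ψ.functor.map φ) ∈ 𝔭'.submonoid)) →
        (∀ ⦃B : C₁⦄ (ψ : B ⟶ A), PreFrobenioid.IsCoAngularPreStep F₁ ψ →
            ((∃ y ∈ 𝔭.submonoid, pull Φ₁ (PreFrobenioid.Base F₁ ψ) y = PreFrobenioid.Div F₁ ψ) ↔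
              ∃ y ∈ 𝔭'.submonoid,
                pull Φ₂ (PreFrobenioid.Base F₂ (Ψ.functor.map ψ)) y = PreFrobenioid.Div F₂ (Ψ.functor.map ψ))) →
        (∃ r : 𝔭.submonoid ≃* 𝔭'.submonoid, ∀ ⦃B : C₁⦄ (φ : A ⟶ B),
            PreFrobenioid.IsCoAngularPreStep F₁ φ → ∀ h : PreFrobenioid.Div F₁ φ ∈ 𝔭.submonoid,
              (r ⟨PreFrobenioid.Div F₁ φ, h⟩ : Φ₂.obj (op (PreFrobenioid.baseObj F₂ (Ψ.functor.obj A)))) =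
                PreFrobenioid.Div F₂ (Ψ.functor.map φ)) ∧
        ∃ l : 𝔭.submonoid ≃* 𝔭'.submonoid, ∀ ⦃B : C₁⦄ (ψ : B ⟶ A),
            PreFrobenioid.IsCoAngularPreStep F₁ ψ →
              ∀ (y : Φ₁.obj (op (PreFrobenioid.baseObj F₁ A))) (h : y ∈ 𝔭.submonoid),
                pull Φ₁ (PreFrobenioid.Base F₁ ψ) y = PreFrobenioid.Div F₁ ψ →
                  pull Φ₂ (PreFrobenioid.Base F₂ (Ψ.functor.map ψ))
                    (l ⟨y, h⟩ : Φ₂.obj (op (PreFrobenioid.baseObj F₂ (Ψ.functor.obj A)))) =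
                    PreFrobenioid.Div F₂ (Ψ.functor.map ψ)

end FrdI.T42

end Literature.AlgebraicGeometry.Frobenioids
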